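import Literature.MathematicalPhysics.QuantumFieldTheory.Balaban1983to89.B1Eq324BenfattoCondCentre
import Literature.MathematicalPhysics.QuantumFieldTheory.Balaban1983to89.B1Eq324BenfattoAppendixC
import HarnessLib

/-!
# `Balaban1983to89.B1Eq324BenfattoAppendixCLemma2` — [BenfattoEtAl1978] Appendix C p. 165, LEMMA 2 (the small-field volume of the
# CONDITIONED free field): PROVED in the tree's regression vocabulary, under the side condition the tree's centre bound yields

statement-level skeleton of published theorems with citation tags; proofs where landed; nothing here is a claim about the
Yang–Mills mass gap

WHY THIS MODULE (cell `pub-ymgap`, seat `dag-n08-b`, node N08 «first missing estimate» lane; sequel of `B1Eq324BenfattoAppendixA`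
(App. A), `B1Eq324BenfattoAppendixC` (App. C Lemma 1, (C.6) diagonal) and `B1Eq324BenfattoCondCentre` ((C.8)-type centre bound)).
Lemma 2 of Appendix C is the third and last Gaussian input of §5's proof of the p. 152 Basic Lemma of [BenfattoEtAl1978]
(`B1Eq324BenfattoLemma.BasicLemmaPrinted` ⇐ [Balaban1982Higgs1] (3.24) ⇐ [Balaban1985UV3] (24)/(58)).

THE PRINTED TEXT (p. 165, verbatim from the page images, lit-balaban desk ME #23): *"**Lemma 2.** Let Γ, I, □ be regions paved
by Q₀, let z̄_Γ ≡ (z̄_Δ)_{Δ∈Γ} be a given family of numbers such that |z̄_Δ| ≦ γb(1 + d(I, Δ)) and let P(dz/z̄_Γ) be the measure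
(C.1) conditioned to the values z̄_Γ, then:* `∫ Π_{Δ⊂□} χ(|z_Δ| < b(1 + d(Δ, I))) P(dz|z̄_Γ) ≧ (1 − 2|□|e^{−b²/4})` *if*
`γ ≦ ½(2d/(α² + 2d))²`. *Proof. Since the covariance with Dirichelet boundary conditions is bounded by (C.6) and since the center of
the measure P(dz_□|z̄_Γ) is bounded as in (C.8) the above lemma is an immediate consequence of Lemma 1."*  Desk note (c), recorded
[sic]: reading the one-line proof as «recentre by u_Δ, one-site tail with variance ≤ ½ ((C.4),(C.6)), union over □» reproduces
`2|□|e^{−b²/4}` exactly when the centre leaves the margin `½b(1 + d(Δ, I))`, i.e. when `γ × (the constant of (C.8)) ≤ ½`; with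
(C.8) as printed that is `γ ≤ ½(α²/(α² + 2d))²`, whereas the printed side condition has `2d` in the numerator — a print-internal
`α² ↔ 2d` transposition.  This file proves the Lemma with the side condition that the TREE's centre bound
(`B1Eq324BenfattoCondCentre.abs_condMean_freeCov_le'`, constant `(α² + 2d)/α²`) makes true: `γ(1 + 2d/α²) ≤ ½`.

DICTIONARY (as in `B1Eq324BenfattoLemma`): `P(dz|z̄_Γ)` ↦ `condField d α β Γ z̄` (the Schur-complement Gaussian field shifted by
the regression mean `condMean`); `Π_{Δ⊂□} χ(|z_Δ| < b(1 + d(Δ,I)))` ↦ the event `{z | ∀ x ∈ box, |z x| < b(1 + distToRegion I x)}`;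
`|□|` ↦ `box.card`; the normalisation «E z_Δ² = ½» ↦ the hypothesis `freeCov d α β 0 0 ≤ 1/2` (only the upper bound is used).
FIDELITY OF THE DICTIONARY (referee condition (c1) on `B1Eq324BenfattoCondCentre`): `condMean`/`condCov` are print's (C.7) centre /
«Dirichelet» covariance exactly on the branch where the Gram matrix `K_ΓΓ = covGram (freeCov d α β) Γ` is invertible; on a
singular Gram matrix Mathlib's `M⁻¹ = 0` would make `condField = P̂₀`.  For the free field the singular branch does NOT occur
(`K_ΓΓ` is positive DEFINITE: the momentum integral (C.2) has a strictly positive weight and distinct characters are independent —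
landing separately in this seat's App. C point 1) module); the theorem below is proved on BOTH branches and needs neither.
SIDE CONDITION, AS PRINTED vs AS PROVED (referee remark (r2)): printed «γ ≦ ½(2d/(α² + 2d))²»; proved here under
`γ(1 + 2d/α²) ≤ ½`, the margin condition the tree's (C.8) constant `(α² + 2d)/α²` yields (print's own (C.8) constant would give
`γ((α² + 2d)/α²)² ≤ ½`; neither equals the printed side condition — the desk-recorded transposition).

WHAT IS PROVED (no definition, no named fact, no `sorry`; axioms standard).
* §1 **`isPosSemidefKernel_condCov_freeCov`** — the conditional ("Dirichelet") covariance `condCov (freeCov d α β) Γ` IS a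
  positive semidefinite kernel (so the tree's `condField` is a genuine Gaussian field, not a junk value): for an invertible Gram
  matrix `K_ΓΓ` the Schur quadratic form `cᵀ(K_II − K_IΓK_ΓΓ⁻¹K_ΓI)c` is the free quadratic form at the combined family
  `(I, c) ∪ (Γ, −K_ΓΓ⁻¹K_ΓIc)` (repetitions allowed: `B3WTFreeMeasure.sum_sum_mul_mul_CetaM_nonneg`); a singular `K_ΓΓ` has
  Mathlib inverse `0` and `condCov = freeCov`.
* §2 **`condField_real_abs_ge_le`** — one site of the conditioned field: `P(|z_x| ≥ t | z̄_Γ) ≤ 2exp(−(t − |u_x|)²/(2C))` for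
  `t ≥ |u_x|`, `C ≥ E z_Δ²` (the centred Schur field has one-site variance `condCov x x ≤ freeCov x x`,
  `B1Eq324BenfattoAppendixC.condCov_self_le`; Chernoff tails `GaussianSmallField.gaussianReal_real_abs_sub_mean_ge_le`).
* §3 **`appC_lemma2`** — LEMMA 2 with the tree's side condition: `α, β > 0`, `E z_Δ² ≤ ½`, `b > 0`, `0 ≤ γ`, `γ(1 + 2d/α²) ≤ ½`,
  data `|z̄_c| ≤ γb(1 + d(Δ_c, I))` on Γ ⟹ `1 − 2|□|e^{−b²/4} ≤ P(|z_Δ| < b(1 + d(Δ, I)) ∀Δ ∈ □ | z̄_Γ)` (union bound over □;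
  margin `b(1 + d) − |u| ≥ ½b(1 + d) ≥ ½b`, variance `≤ ½`).

NOT HERE: the printed side condition `γ ≦ ½(2d/(α²+2d))²` (see the [sic] above; not derivable from (C.8) as printed either); (C.6)
entrywise, (C.2)–(C.5), (C.7) as a formula.  NOT summit progress; count-neutral for N08; nothing of [Balaban1985UV3] is asserted.
-/

noncomputable section

open MeasureTheory ProbabilityTheory Finset Matrix
open scoped BigOperators Matrix NNReal ENNReal

namespace Literature.MathematicalPhysics.QuantumFieldTheory.Balaban1983to89.B1Eq324BenfattoAppendixCLemma2

open Literature.MathematicalPhysics.QuantumFieldTheory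
open Literature.MathematicalPhysics.QuantumFieldTheory.Balaban1983to89.B3WT226FreeLattice
open Literature.MathematicalPhysics.QuantumFieldTheory.Balaban1983to89.B3WTFreeMeasure
open Literature.MathematicalPhysics.QuantumFieldTheory.Balaban1983to89.B1Eq324BenfattoLemma
open Literature.MathematicalPhysics.QuantumFieldTheory.Balaban1983to89.B1Eq324BenfattoAppendixA
open Literature.MathematicalPhysics.QuantumFieldTheory.Balaban1983to89.B1Eq324BenfattoAppendixC
open Literature.MathematicalPhysics.QuantumFieldTheory.Balaban1983to89.B1Eq324BenfattoCondCentre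

variable {d : ℕ}

/-! ## §1  The conditional covariance of the free field is a positive semidefinite kernel -/

/-- The free quadratic form is non-negative along ARBITRARY finite families of sites (repetitions allowed).
[cite: BenfattoEtAl1978, (1.1) p.144] -/
theorem sum_sum_mul_mul_freeCov_nonneg {α β : ℝ} (hα : 0 < α) (hβ : 0 < β) (J : Type) [Fintype J]
    (p : J → B1Eq324BenfattoLemma.Site d) (e : J → ℝ) :
    0 ≤ ∑ s, ∑ t, e s * e t * freeCov d α β (p s) (p t) := by
  have h := sum_sum_mul_mul_CetaM_nonneg (d := d) one_pos (pow_pos hα 2) J p e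
  have hexp : ∑ s, ∑ t, e s * e t * freeCov d α β (p s) (p t) =
      β⁻¹ * ∑ s, ∑ t, e s * e t * CetaM d 1 (α ^ 2) (p s - p t) := by
    simp only [freeCov, Finset.mul_sum]
    refine Finset.sum_congr rfl fun s _ => Finset.sum_congr rfl fun t _ => ?_
    ring
  rw [hexp]
  exact mul_nonneg (inv_pos.2 hβ).le h

/-- **THE CONDITIONAL COVARIANCE IS A POSITIVE SEMIDEFINITE KERNEL**: `condCov (freeCov d α β) Γ` — print's `C^Γ`, the covariance
«with Dirichelet boundary condition on Γ» of the conditioned field (C.6)/(C.7) — has positive semidefinite Gram matrices, so the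
tree's `condField d α β Γ z̄` is an honest Gaussian field. [cite: BenfattoEtAl1978, Appendix C (C.6) p.164] -/
theorem isPosSemidefKernel_condCov_freeCov {α β : ℝ} (hα : 0 < α) (hβ : 0 < β)
    (Γ : Finset (B1Eq324BenfattoLemma.Site d)) : IsPosSemidefKernel (condCov (freeCov d α β) Γ) := by
  intro I
  set K := freeCov d α β with hK
  set A : Matrix Γ Γ ℝ := covGram K Γ with hA
  have hKs : ∀ x y, K x y = K y x := fun x y => freeCov_comm α β x y
  have hAs : Aᵀ = A := by
    ext s t
    simp only [Matrix.transpose_apply, hA, covGram_apply, hKs]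
  have hAinv : ∀ s t : Γ, A⁻¹ s t = A⁻¹ t s := by
    intro s t
    have h := congrFun (congrFun (Matrix.transpose_nonsing_inv A) t) s
    rw [Matrix.transpose_apply, hAs] at h
    exact h
  refine Matrix.PosSemidef.of_dotProduct_mulVec_nonneg (Matrix.IsHermitian.ext fun s t => ?_) fun c => ?_
  · -- symmetry of `condCov`
    simp only [covGram_apply, star_trivial, condCov]
    rw [hKs (t : B1Eq324BenfattoLemma.Site d) s]
    congr 1
    rw [Finset.sum_comm]
    refine Finset.sum_congr rfl fun c₁ _ => Finset.sum_congr rfl fun c₂ _ => ?_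
    rw [hAinv c₂ c₁, hKs (t : B1Eq324BenfattoLemma.Site d) c₂, hKs c₁ (s : B1Eq324BenfattoLemma.Site d)]
    ring
  · rw [star_trivial]
    -- the quadratic form `Q(c) = cᵀK_IIc − (Bc)ᵀA⁻¹(Bc)`, `(Bc)_γ = Σ_x K γ x c_x`
    set Bc : Γ → ℝ := fun γ => ∑ x : I, K γ x * c x with hBc
    have hQ : c ⬝ᵥ (covGram (condCov K Γ) I *ᵥ c) =
        ∑ x : I, ∑ y : I, c x * c y * K x y - Bc ⬝ᵥ (A⁻¹ *ᵥ Bc) := by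
      have h1 : c ⬝ᵥ (covGram (condCov K Γ) I *ᵥ c) =
          ∑ x : I, ∑ y : I, c x * c y * K x y -
            ∑ x : I, ∑ y : I, c x * c y * (∑ γ : Γ, ∑ γ' : Γ, K x γ * A⁻¹ γ γ' * K γ' y) := by
        simp only [dotProduct, Matrix.mulVec, covGram_apply, condCov, hA]
        rw [← Finset.sum_sub_distrib]
        refine Finset.sum_congr rfl fun x _ => ?_
        rw [Finset.mul_sum, ← Finset.sum_sub_distrib]
        refine Finset.sum_congr rfl fun y _ => ?_
        ring
      -- the canonical quadruple sum
      have hL : ∑ x : I, ∑ y : I, c x * c y * (∑ γ : Γ, ∑ γ' : Γ, K x γ * A⁻¹ γ γ' * K γ' y) =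
          ∑ x : I, ∑ y : I, ∑ γ : Γ, ∑ γ' : Γ, c x * c y * K γ x * A⁻¹ γ γ' * K γ' y := by
        refine Finset.sum_congr rfl fun x _ => Finset.sum_congr rfl fun y _ => ?_
        rw [Finset.mul_sum]
        refine Finset.sum_congr rfl fun γ _ => ?_
        rw [Finset.mul_sum]
        refine Finset.sum_congr rfl fun γ' _ => ?_
        rw [hKs (x : B1Eq324BenfattoLemma.Site d) γ]
        ring
      have hR : Bc ⬝ᵥ (A⁻¹ *ᵥ Bc) = ∑ x : I, ∑ y : I, ∑ γ : Γ, ∑ γ' : Γ, c x * c y * K γ x * A⁻¹ γ γ' * K γ' y := by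
        -- `Bc ⬝ (A⁻¹ Bc) = Σ_γ Σ_γ' Σ_x Σ_y …`, then reorder to `Σ_x Σ_y Σ_γ Σ_γ'`
        have e1 : Bc ⬝ᵥ (A⁻¹ *ᵥ Bc) = ∑ γ : Γ, ∑ γ' : Γ, ∑ x : I, ∑ y : I, c x * c y * K γ y * A⁻¹ γ γ' * K γ' x := by
          simp only [dotProduct, Matrix.mulVec, hBc, Finset.mul_sum, Finset.sum_mul]
          refine Finset.sum_congr rfl fun γ _ => Finset.sum_congr rfl fun γ' _ =>
            Finset.sum_congr rfl fun x _ => Finset.sum_congr rfl fun y _ => ?_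
          ring
        rw [e1]
        -- (γ, γ', x, y) → (x, y, γ, γ') → rename x ↔ y
        calc ∑ γ : Γ, ∑ γ' : Γ, ∑ x : I, ∑ y : I, c x * c y * K γ y * A⁻¹ γ γ' * K γ' x
            = ∑ γ : Γ, ∑ x : I, ∑ γ' : Γ, ∑ y : I, c x * c y * K γ y * A⁻¹ γ γ' * K γ' x :=
              Finset.sum_congr rfl fun γ _ => Finset.sum_comm
          _ = ∑ x : I, ∑ γ : Γ, ∑ γ' : Γ, ∑ y : I, c x * c y * K γ y * A⁻¹ γ γ' * K γ' x := Finset.sum_comm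
          _ = ∑ x : I, ∑ γ : Γ, ∑ y : I, ∑ γ' : Γ, c x * c y * K γ y * A⁻¹ γ γ' * K γ' x :=
              Finset.sum_congr rfl fun x _ => Finset.sum_congr rfl fun γ _ => Finset.sum_comm
          _ = ∑ x : I, ∑ y : I, ∑ γ : Γ, ∑ γ' : Γ, c x * c y * K γ y * A⁻¹ γ γ' * K γ' x :=
              Finset.sum_congr rfl fun x _ => Finset.sum_comm
          _ = ∑ y : I, ∑ x : I, ∑ γ : Γ, ∑ γ' : Γ, c x * c y * K γ y * A⁻¹ γ γ' * K γ' x := Finset.sum_comm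
          _ = ∑ x : I, ∑ y : I, ∑ γ : Γ, ∑ γ' : Γ, c x * c y * K γ x * A⁻¹ γ γ' * K γ' y :=
              Finset.sum_congr rfl fun a _ => Finset.sum_congr rfl fun b _ =>
                Finset.sum_congr rfl fun γ _ => Finset.sum_congr rfl fun γ' _ => by ring
      rw [h1, hL, hR]
    rw [hQ]
    by_cases hdet : IsUnit A.det
    · -- the combined family `(I, c) ∪ (Γ, w)`, `w = −A⁻¹(Bc)`
      set w : Γ → ℝ := -(A⁻¹ *ᵥ Bc) with hw
      have hAw : A *ᵥ w = -Bc := by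
        rw [hw, Matrix.mulVec_neg, Matrix.mulVec_mulVec, Matrix.mul_nonsing_inv _ hdet, Matrix.one_mulVec]
      have hpos := sum_sum_mul_mul_freeCov_nonneg (d := d) hα hβ (I ⊕ Γ)
        (Sum.elim (fun x : I => (x : B1Eq324BenfattoLemma.Site d)) (fun γ : Γ => (γ : B1Eq324BenfattoLemma.Site d)))
        (Sum.elim c w)
      -- expand the combined quadratic form over the sum type
      have hsplit : ∑ s : I ⊕ Γ, ∑ t : I ⊕ Γ, Sum.elim c w s * Sum.elim c w t *
          freeCov d α β (Sum.elim (fun x : I => (x : B1Eq324BenfattoLemma.Site d))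
            (fun γ : Γ => (γ : B1Eq324BenfattoLemma.Site d)) s)
            (Sum.elim (fun x : I => (x : B1Eq324BenfattoLemma.Site d)) (fun γ : Γ => (γ : B1Eq324BenfattoLemma.Site d)) t) =
          ∑ x : I, ∑ y : I, c x * c y * K x y + 2 * (w ⬝ᵥ Bc) + w ⬝ᵥ (A *ᵥ w) := by
        rw [Fintype.sum_sum_type]
        simp only [Fintype.sum_sum_type, Sum.elim_inl, Sum.elim_inr]
        have hcross1 : ∑ x : I, ∑ γ : Γ, c x * w γ * K x γ = w ⬝ᵥ Bc := by
          simp only [dotProduct, hBc, Finset.mul_sum]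
          rw [Finset.sum_comm]
          refine Finset.sum_congr rfl fun γ _ => Finset.sum_congr rfl fun x _ => ?_
          rw [hKs (x : B1Eq324BenfattoLemma.Site d) γ]
          ring
        have hcross2 : ∑ γ : Γ, ∑ x : I, w γ * c x * K γ x = w ⬝ᵥ Bc := by
          simp only [dotProduct, hBc, Finset.mul_sum]
          refine Finset.sum_congr rfl fun γ _ => Finset.sum_congr rfl fun x _ => ?_
          ring
        have hAA : ∑ γ : Γ, ∑ γ' : Γ, w γ * w γ' * K γ γ' = w ⬝ᵥ (A *ᵥ w) := by
          simp only [dotProduct, Matrix.mulVec, hA, covGram_apply, Finset.mul_sum]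
          refine Finset.sum_congr rfl fun γ _ => Finset.sum_congr rfl fun γ' _ => ?_
          ring
        rw [Finset.sum_add_distrib, Finset.sum_add_distrib, hcross1, hcross2, hAA]
        ring
      rw [hsplit, hAw, dotProduct_neg] at hpos
      have hfin : ∑ x : I, ∑ y : I, c x * c y * K x y - Bc ⬝ᵥ (A⁻¹ *ᵥ Bc) =
          ∑ x : I, ∑ y : I, c x * c y * K x y + 2 * (w ⬝ᵥ Bc) + -(w ⬝ᵥ Bc) := by
        rw [hw, neg_dotProduct, dotProduct_comm (A⁻¹ *ᵥ Bc) Bc]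
        ring
      rw [hfin]
      exact hpos
    · -- singular Gram matrix: Mathlib's inverse is `0`
      rw [Matrix.nonsing_inv_apply_not_isUnit _ hdet, Matrix.zero_mulVec, dotProduct_zero, sub_zero]
      have h := sum_sum_mul_mul_freeCov_nonneg (d := d) hα hβ I (fun x => (x : B1Eq324BenfattoLemma.Site d)) c
      simpa [hK] using h

/-! ## §2  One site of the conditioned field -/

/-- **One-site large-field probability of the conditioned field**: for `α, β > 0`, a site `x`, a variance bound
`freeCov d α β 0 0 ≤ C` (`C > 0`) and a level `t ≥ |u_x|` (`u = condMean`), `P(|z_x| ≥ t | z̄_Γ) ≤ 2exp(−(t − |u_x|)²/(2C))`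
(recentre: `|z_x| ≥ t ⇒ |z_x − u_x| ≥ t − |u_x|`; the centred coordinate is `N(0, C^Γ_xx)` with `C^Γ_xx ≤ C_xx ≤ C`).
[cite: BenfattoEtAl1978, Appendix C Lemma 2 p.165] -/
theorem condField_real_abs_ge_le {α β : ℝ} (hα : 0 < α) (hβ : 0 < β) (Γ : Finset (B1Eq324BenfattoLemma.Site d))
    (zbar : B1Eq324BenfattoLemma.Site d → ℝ) (x : B1Eq324BenfattoLemma.Site d) {C t : ℝ} (hC : 0 < C)
    (hvar : freeCov d α β 0 0 ≤ C) (ht : |condMean (freeCov d α β) Γ zbar x| ≤ t) :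
    (condField d α β Γ zbar).real {z | t ≤ |z x|} ≤
      2 * Real.exp (-((t - |condMean (freeCov d α β) Γ zbar x|) ^ 2 / (2 * C))) := by
  set K := freeCov d α β with hK
  set u := condMean K Γ zbar with hu
  have hKc := isPosSemidefKernel_condCov_freeCov (d := d) hα hβ Γ
  set Q := gaussianFieldOfKernel (condCov K Γ) with hQ
  haveI := isProbabilityMeasure_gaussianFieldOfKernel hKc
  -- the shift map
  set T : (B1Eq324BenfattoLemma.Site d → ℝ) → (B1Eq324BenfattoLemma.Site d → ℝ) := fun ζ y => u y + ζ y with hT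
  have hTm : Measurable T := measurable_pi_lambda _ fun y => measurable_const.add (measurable_pi_apply y)
  have hP : condField d α β Γ zbar = Q.map T := rfl
  have hmeas : MeasurableSet {z : B1Eq324BenfattoLemma.Site d → ℝ | t ≤ |z x|} :=
    measurableSet_le measurable_const (continuous_abs.measurable.comp (measurable_pi_apply x))
  rw [hP, map_measureReal_apply hTm hmeas]
  -- `T⁻¹{t ≤ |z_x|} ⊆ {t − |u_x| ≤ |ζ_x − 0|}`
  have hsub : T ⁻¹' {z : B1Eq324BenfattoLemma.Site d → ℝ | t ≤ |z x|} ⊆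
      (fun ζ : B1Eq324BenfattoLemma.Site d → ℝ => ζ x) ⁻¹' {r : ℝ | t - |u x| ≤ |r - 0|} := by
    intro ζ hζ
    simp only [Set.mem_preimage, Set.mem_setOf_eq, hT, sub_zero] at hζ ⊢
    have := abs_add_le (u x) (ζ x)
    linarith
  -- the centred coordinate is Gaussian with variance `condCov x x ≤ C`
  have hX : HasGaussianLaw (fun ζ : B1Eq324BenfattoLemma.Site d → ℝ => ζ x) Q :=
    (isGaussianProcess_eval_gaussianFieldOfKernel hKc).hasGaussianLaw_eval x
  have hmap := hX.map_eq_gaussianReal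
  have hmean : ∫ ζ, ζ x ∂Q = 0 := integral_eval_gaussianFieldOfKernel hKc x
  have hv : Var[fun ζ : B1Eq324BenfattoLemma.Site d → ℝ => ζ x; Q] = condCov K Γ x x := by
    rw [← covariance_self (measurable_pi_apply x).aemeasurable, covariance_eval_gaussianFieldOfKernel hKc x x]
  rw [hmean, hv] at hmap
  have hvC : (((condCov K Γ x x).toNNReal : ℝ≥0) : ℝ) ≤ C := by
    rw [Real.coe_toNNReal']
    refine max_le ?_ hC.le
    exact ((condCov_self_le (isPosSemidefKernel_freeCov hα hβ) Γ x).trans ((freeCov_self α β x).le.trans hvar))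
  have hmeas' : MeasurableSet {r : ℝ | t - |u x| ≤ |r - 0|} := measurableSet_le measurable_const (by fun_prop)
  calc Q.real (T ⁻¹' {z | t ≤ |z x|})
      ≤ Q.real ((fun ζ : B1Eq324BenfattoLemma.Site d → ℝ => ζ x) ⁻¹' {r : ℝ | t - |u x| ≤ |r - 0|}) :=
        measureReal_mono hsub (measure_ne_top _ _)
    _ = (Q.map fun ζ : B1Eq324BenfattoLemma.Site d → ℝ => ζ x).real {r : ℝ | t - |u x| ≤ |r - 0|} :=
        (map_measureReal_apply (measurable_pi_apply x) hmeas').symm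
    _ ≤ 2 * Real.exp (-((t - |u x|) ^ 2 / (2 * C))) := by
        rw [hmap]
        exact GaussianSmallField.gaussianReal_real_abs_sub_mean_ge_le (m := 0) hC hvC (sub_nonneg.2 ht)

/-! ## §3  Lemma 2 -/

/-- **LEMMA 2 OF APPENDIX C of [BenfattoEtAl1978] (p. 165), with the tree's side condition**: for the free field (1.1) with
`α, β > 0` and one-site variance `E z_Δ² ≤ ½` (print: `= ½`), `b > 0`, a boundary-data ratio `γ ≥ 0` with `γ(1 + 2d/α²) ≤ ½`
(print: `γ ≦ ½(2d/(α²+2d))²` [sic], see the header), regions `Γ, I, □` and data `|z̄_Δ| ≦ γb(1 + d(I, Δ))` on `Γ`: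
`∫ Π_{Δ⊂□} χ(|z_Δ| < b(1 + d(Δ, I))) P(dz|z̄_Γ) ≧ 1 − 2|□|e^{−b²/4}`.  Route = print's one line: centre within half the margin
(`B1Eq324BenfattoCondCentre.abs_condMean_freeCov_le'`), one-site variance `≤ ½` ((C.6): `condCov_self_le`), union over □.
[cite: BenfattoEtAl1978, Appendix C Lemma 2 p.165] -/
theorem appC_lemma2 {α β γ b : ℝ} (hα : 0 < α) (hβ : 0 < β) (hvar : freeCov d α β 0 0 ≤ 1 / 2) (hb : 0 < b)
    (hγ0 : 0 ≤ γ) (hγ : γ * (1 + 2 * d / α ^ 2) ≤ 1 / 2) (Γ I box : Finset (B1Eq324BenfattoLemma.Site d))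
    (zbar : B1Eq324BenfattoLemma.Site d → ℝ) (hz : ∀ c ∈ Γ, |zbar c| ≤ γ * b * (1 + distToRegion I c)) :
    1 - 2 * (box.card : ℝ) * Real.exp (-(b ^ 2 / 4)) ≤
      (condField d α β Γ zbar).real {z | ∀ x ∈ box, |z x| < b * (1 + distToRegion I x)} := by
  set P := condField d α β Γ zbar with hP
  set u := condMean (freeCov d α β) Γ zbar with hu
  have hKc := isPosSemidefKernel_condCov_freeCov (d := d) hα hβ Γ
  haveI : IsProbabilityMeasure P := by
    rw [hP, condField]
    haveI := isProbabilityMeasure_gaussianFieldOfKernel hKc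
    exact Measure.isProbabilityMeasure_map
      (measurable_pi_lambda _ fun y => measurable_const.add (measurable_pi_apply y)).aemeasurable
  have hγb : 0 ≤ γ * b := mul_nonneg hγ0 hb.le
  -- the complement is covered by the one-site large-field events
  set E : Set (B1Eq324BenfattoLemma.Site d → ℝ) := {z | ∀ x ∈ box, |z x| < b * (1 + distToRegion I x)} with hE
  have hEmeas : MeasurableSet E := by
    have : E = ⋂ x ∈ box, {z : B1Eq324BenfattoLemma.Site d → ℝ | |z x| < b * (1 + distToRegion I x)} := by
      ext z
      simp only [hE, Set.mem_setOf_eq, Set.mem_iInter]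
    rw [this]
    exact MeasurableSet.biInter (Finset.countable_toSet box) fun x _ =>
      measurableSet_lt (continuous_abs.measurable.comp (measurable_pi_apply x)) measurable_const
  have hcompl : Eᶜ ⊆ ⋃ x ∈ box, {z : B1Eq324BenfattoLemma.Site d → ℝ | b * (1 + distToRegion I x) ≤ |z x|} := by
    intro z hz
    simp only [hE, Set.mem_compl_iff, Set.mem_setOf_eq, not_forall, not_lt] at hz
    obtain ⟨x, hx, hle⟩ := hz
    exact Set.mem_biUnion hx hle
  -- one site: margin `≥ b/2`, variance `≤ 1/2`
  have hsite : ∀ x ∈ box, P.real {z | b * (1 + distToRegion I x) ≤ |z x|} ≤ 2 * Real.exp (-(b ^ 2 / 4)) := by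
    intro x _
    have hd0 : 0 ≤ distToRegion I x := distToRegion_nonneg I x
    have hux : |u x| ≤ (1 + 2 * d / α ^ 2) * (γ * b) * (1 + distToRegion I x) :=
      abs_condMean_freeCov_le' hα hβ hγb Γ I zbar hz x
    have hmargin : b / 2 ≤ b * (1 + distToRegion I x) - |u x| := by
      have h1 : (1 + 2 * d / α ^ 2) * (γ * b) * (1 + distToRegion I x) ≤ b / 2 * (1 + distToRegion I x) := by
        have : (1 + 2 * d / α ^ 2) * (γ * b) = γ * (1 + 2 * d / α ^ 2) * b := by ring
        rw [this]
        exact mul_le_mul_of_nonneg_right (by nlinarith) (by linarith)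
      nlinarith
    have ht : |u x| ≤ b * (1 + distToRegion I x) := by linarith
    have h := condField_real_abs_ge_le hα hβ Γ zbar x (C := 1 / 2) (by norm_num) hvar ht
    refine h.trans ?_
    refine mul_le_mul_of_nonneg_left (Real.exp_le_exp.2 ?_) (by norm_num)
    have hsq : (b / 2) ^ 2 ≤ (b * (1 + distToRegion I x) - |u x|) ^ 2 :=
      pow_le_pow_left₀ (by linarith) hmargin 2
    have : b ^ 2 / 4 = (b / 2) ^ 2 / (2 * (1 / 2)) := by ring
    rw [this]
    exact neg_le_neg (div_le_div_of_nonneg_right hsq (by norm_num))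
  -- assemble
  have h1 : P.real Eᶜ ≤ 2 * (box.card : ℝ) * Real.exp (-(b ^ 2 / 4)) := by
    calc P.real Eᶜ ≤ P.real (⋃ x ∈ box, {z : B1Eq324BenfattoLemma.Site d → ℝ | b * (1 + distToRegion I x) ≤ |z x|}) :=
          measureReal_mono hcompl (measure_ne_top _ _)
      _ ≤ ∑ x ∈ box, P.real {z : B1Eq324BenfattoLemma.Site d → ℝ | b * (1 + distToRegion I x) ≤ |z x|} :=
          measureReal_biUnion_finset_le _ _
      _ ≤ ∑ _x ∈ box, 2 * Real.exp (-(b ^ 2 / 4)) := Finset.sum_le_sum hsite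
      _ = 2 * (box.card : ℝ) * Real.exp (-(b ^ 2 / 4)) := by
          rw [Finset.sum_const, nsmul_eq_mul]
          ring
  have h2 : P.real E + P.real Eᶜ = 1 := probReal_add_probReal_compl hEmeas
  linarith

end Literature.MathematicalPhysics.QuantumFieldTheory.Balaban1983to89.B1Eq324BenfattoAppendixCLemma2

end
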